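import Mathlib
import Literature.Analysis.OperatorTheory.KernelMatrixOperators
import Literature.Analysis.OperatorTheory.KernelConjugation
import Literature.Analysis.OperatorTheory.WeaklyHolomorphicFamily
import Literature.Analysis.Complex.ConeTubeIdentity
import HarnessLib

/-!
# The holomorphic contraction family `e^{-tH + iyP}` on the light-cone tube, from kernel data

Abstract Osterwalder–Schrader packaging of an IN-PLANE LIGHT CONE hypothesis. Setting: a complex
Hilbert space `H` with kernel vectors `δ : X → H` of dense span and real Gram matrix
(`KernelMatrixOperators`, `KernelConjugation`), and a two-parameter relabelling `σ t y : X → X`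
(time shift `t` and transverse shift `y` of Euclidean configurations). The hypothesis `hLC` says:
for all finite REAL combinations, the matrix element `(t, y) ↦ ⟪Σ rᵢ δ_{xᵢ}, Σ r'ⱼ δ_{σ_{t,y} yⱼ}⟫`
(`t > 0`) is the restriction of a function holomorphic on the forward tube
`𝒯 = {(t, y) : |Im y| < Re t}` and bounded there by the product of the norms — the correlation-function
form of the spectral condition `|P| ≤ H` (Glimm–Jaffe, *Quantum Physics* (1987), §19.5, there DERIVED
from Euclidean covariance; Streater, CMP 26 (1972)).

## Results (namespace `Literature.Analysis.OperatorTheory.KernelVectors`; all proved)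

* `exists_coneFamily`: there is an operator family `N : ℂ × ℂ → (H →L[ℂ] H)` ("`e^{-tH+iyP}`") with
  `‖N p‖ ≤ 8` on `𝒯`, matrix elements `p ↦ ⟪δ_a, N p δ_b⟫` holomorphic on `𝒯`, the REPRODUCTION
  identity `N (t, y) δ_b = δ_{σ_{t,y} b}` at real `t > 0`, and the reality relation
  `⟪δ_a, N p̄ δ_b⟫ = conj ⟪δ_a, N p δ_b⟫`. (Operators from the real and imaginary parts of the
  bounded matrices `G_{ab}(p)`, `exists_clm_of_real_bound`; sesquilinearity of the continuations by
  the identity theorem on the tube, `eqOn_coneTube_of_eq_ofReal`.) No semigroup law is claimed.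
* `differentiableOn_coneFamily_comp`: along a holomorphic curve `q : U → 𝒯` the family
  `z ↦ N (q z)` is holomorphic IN OPERATOR NORM (weak holomorphy on the span + Dunford's theorem,
  `differentiableOn_of_forall_differentiableOn_inner`).
* `conjOp_coneFamily_apply`: `J N(p) = N(p̄) J` for the conjugation `J` of `KernelConjugation`.

## References
* J. Glimm, A. Jaffe, *Quantum Physics* (2nd ed. 1987), §19.5 (light cone of the transfer matrix).
* R. F. Streater, Connection between the spectrum condition and the Lorentz invariance of `P(φ)₂`,
  CMP 26 (1972) 109–120.
* K. Osterwalder, R. Schrader, CMP 31 (1973) §4.1; CMP 42 (1975) §V.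
-/

noncomputable section

open Filter ComplexConjugate
open scoped InnerProductSpace Topology
open Literature.Analysis.Complex

namespace Literature.Analysis.OperatorTheory

namespace KernelVectors

variable {X : Type*} {H : Type*} [NormedAddCommGroup H] [InnerProductSpace ℂ H]

/-- A bounded operator acts coefficientwise on combinations of kernel vectors. [folklore] -/
theorem clm_lc (δ : X → H) (T : H →L[ℂ] H) (c : X →₀ ℂ) :
    T (Finsupp.linearCombination ℂ δ c) = Finsupp.linearCombination ℂ (⇑T ∘ δ) c := by
  simp only [Finsupp.linearCombination_apply, Finsupp.sum, map_sum, map_smul, Function.comp_apply]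

/-- Matrix elements of a bounded operator between combinations of kernel vectors. [folklore] -/
theorem inner_lc_clm_lc (δ : X → H) (T : H →L[ℂ] H) (c c' : X →₀ ℂ) :
    ⟪Finsupp.linearCombination ℂ δ c, T (Finsupp.linearCombination ℂ δ c')⟫_ℂ =
      ∑ x ∈ c.support, ∑ y ∈ c'.support, conj (c x) * c' y * ⟪δ x, T (δ y)⟫_ℂ := by
  rw [clm_lc, inner_lc_lc']
  rfl

/-- The conjugate point `(t̄, ȳ)` lies in the forward tube with `(t, y)`. [folklore] -/
theorem conj_mem_coneTube {p : ℂ × ℂ} (hp : |p.2.im| < p.1.re) :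
    |(conj p.2).im| < (conj p.1).re := by
  simpa using hp

variable [CompleteSpace H]

/-- **The holomorphic contraction family on the light-cone tube.** From the in-plane light-cone
hypothesis `hLC` on kernel data (see the module docstring) one obtains operators `N p`, `p` in the
tube `|Im y| < Re t`, uniformly bounded (`‖N p‖ ≤ 8`), with holomorphic matrix elements on the kernel
vectors, reproducing the shifted kernel vectors at real points, `N(t, y) δ_b = δ_{σ_{t,y} b}`, and
real in the sense `⟪δ_a, N(p̄) δ_b⟫ = conj ⟪δ_a, N(p) δ_b⟫`. [cite: GlimmJaffe1987, §19.5] -/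
theorem exists_coneFamily (δ : X → H) (hδ : DenseRange (Finsupp.linearCombination ℂ δ))
    (hreal : ∀ x y, (⟪δ x, δ y⟫_ℂ).im = 0) (σ : ℝ → ℝ → X → X)
    (hLC : ∀ (k : ℕ) (xs : Fin k → X) (r : Fin k → ℝ) (l : ℕ) (ys : Fin l → X) (r' : Fin l → ℝ),
      ∃ G : ℂ × ℂ → ℂ, DifferentiableOn ℂ G {p : ℂ × ℂ | |p.2.im| < p.1.re} ∧
        (∀ t y : ℝ, 0 < t → G ((t : ℂ), (y : ℂ)) =
          ∑ i, ∑ j, (r i : ℂ) * (r' j : ℂ) * ⟪δ (xs i), δ (σ t y (ys j))⟫_ℂ) ∧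
        ∀ p : ℂ × ℂ, |p.2.im| < p.1.re →
          ‖G p‖ ≤ ‖∑ i, (r i : ℂ) • δ (xs i)‖ * ‖∑ j, (r' j : ℂ) • δ (ys j)‖) :
    ∃ N : ℂ × ℂ → (H →L[ℂ] H),
      (∀ p : ℂ × ℂ, |p.2.im| < p.1.re → ‖N p‖ ≤ 8) ∧
      (∀ a b, DifferentiableOn ℂ (fun p => ⟪δ a, N p (δ b)⟫_ℂ) {p : ℂ × ℂ | |p.2.im| < p.1.re}) ∧
      (∀ t y : ℝ, 0 < t → ∀ b, N ((t : ℂ), (y : ℂ)) (δ b) = δ (σ t y b)) ∧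
      (∀ p : ℂ × ℂ, |p.2.im| < p.1.re → ∀ a b,
        ⟪δ a, N (conj p.1, conj p.2) (δ b)⟫_ℂ = conj ⟪δ a, N p (δ b)⟫_ℂ) := by
  classical
  -- the singleton continuations `G a b`
  have hLC1 := fun a b : X => hLC 1 (fun _ => a) (fun _ => 1) 1 (fun _ => b) (fun _ => 1)
  choose G hGd hGval hGbd using hLC1
  have hGval' : ∀ a b (t y : ℝ), 0 < t → G a b ((t : ℂ), (y : ℂ)) = ⟪δ a, δ (σ t y b)⟫_ℂ := by
    intro a b t y ht
    rw [hGval a b t y ht]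
    simp
  have hGbd' : ∀ a b (p : ℂ × ℂ), |p.2.im| < p.1.re → ‖G a b p‖ ≤ ‖δ a‖ * ‖δ b‖ := by
    intro a b p hp
    have := hGbd a b p hp
    simpa using this
  have hGreal : ∀ a b (t y : ℝ), 0 < t → (G a b ((t : ℂ), (y : ℂ))).im = 0 := by
    intro a b t y ht
    rw [hGval' a b t y ht]
    exact hreal _ _
  -- sesquilinearity of the continuations (identity theorem on the tube) gives the real-family bound
  have hcomb : ∀ (k : ℕ) (xs : Fin k → X) (r : Fin k → ℝ) (l : ℕ) (ys : Fin l → X) (r' : Fin l → ℝ)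
      (p : ℂ × ℂ), |p.2.im| < p.1.re →
      ‖∑ i, ∑ j, (r i : ℂ) * (r' j : ℂ) * G (xs i) (ys j) p‖ ≤
        ‖∑ i, (r i : ℂ) • δ (xs i)‖ * ‖∑ j, (r' j : ℂ) • δ (ys j)‖ := by
    intro k xs r l ys r' p hp
    obtain ⟨G', hG'd, hG'val, hG'bd⟩ := hLC k xs r l ys r'
    have heq : (∑ i, ∑ j, (r i : ℂ) * (r' j : ℂ) * G (xs i) (ys j) p) = G' p := by
      refine eqOn_coneTube_of_eq_ofReal
        (f := fun p => ∑ i, ∑ j, (r i : ℂ) * (r' j : ℂ) * G (xs i) (ys j) p) (g := G')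
        ?_ ?_ ?_ ?_ ?_ p hp
      · intro t _
        exact DifferentiableOn.fun_sum
          (A := fun i (y : ℂ) => ∑ j, (r i : ℂ) * (r' j : ℂ) * G (xs i) (ys j) ((t : ℂ), y))
          fun i _ => DifferentiableOn.fun_sum
            (A := fun j (y : ℂ) => (r i : ℂ) * (r' j : ℂ) * G (xs i) (ys j) ((t : ℂ), y))
            fun j _ => ((hGd (xs i) (ys j)).coneTube_slice_snd t).const_mul ((r i : ℂ) * (r' j : ℂ))
      · exact fun t _ => hG'd.coneTube_slice_snd t
      · intro y
        exact DifferentiableOn.fun_sum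
          (A := fun i (t : ℂ) => ∑ j, (r i : ℂ) * (r' j : ℂ) * G (xs i) (ys j) (t, y))
          fun i _ => DifferentiableOn.fun_sum
            (A := fun j (t : ℂ) => (r i : ℂ) * (r' j : ℂ) * G (xs i) (ys j) (t, y))
            fun j _ => ((hGd (xs i) (ys j)).coneTube_slice_fst y).const_mul ((r i : ℂ) * (r' j : ℂ))
      · exact fun y => hG'd.coneTube_slice_fst y
      · intro t y ht
        rw [hG'val t y ht]
        simp only [hGval' _ _ t y ht]
    rw [heq]
    exact hG'bd p hp
  -- the operators, from the real and imaginary parts of the matrices `G · · p`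
  have hT : ∀ p : ℂ × ℂ, |p.2.im| < p.1.re →
      ∃ T : H →L[ℂ] H, (∀ a b, ⟪δ a, T (δ b)⟫_ℂ = G a b p) ∧ ‖T‖ ≤ 8 := by
    intro p hp
    have hre : ∀ (k : ℕ) (xs : Fin k → X) (r : Fin k → ℝ) (l : ℕ) (ys : Fin l → X) (r' : Fin l → ℝ),
        |∑ i, ∑ j, r i * r' j * (G (xs i) (ys j) p).re| ≤
          1 * ‖∑ i, (r i : ℂ) • δ (xs i)‖ * ‖∑ j, (r' j : ℂ) • δ (ys j)‖ := by
      intro k xs r l ys r'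
      have h1 : ∑ i, ∑ j, r i * r' j * (G (xs i) (ys j) p).re =
          (∑ i, ∑ j, (r i : ℂ) * (r' j : ℂ) * G (xs i) (ys j) p).re := by
        rw [Complex.re_sum]; refine Finset.sum_congr rfl fun i _ => ?_
        rw [Complex.re_sum]; refine Finset.sum_congr rfl fun j _ => ?_
        simp [Complex.mul_re]
      rw [h1, one_mul]
      exact (Complex.abs_re_le_norm _).trans (hcomb k xs r l ys r' p hp)
    have him : ∀ (k : ℕ) (xs : Fin k → X) (r : Fin k → ℝ) (l : ℕ) (ys : Fin l → X) (r' : Fin l → ℝ),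
        |∑ i, ∑ j, r i * r' j * (G (xs i) (ys j) p).im| ≤
          1 * ‖∑ i, (r i : ℂ) • δ (xs i)‖ * ‖∑ j, (r' j : ℂ) • δ (ys j)‖ := by
      intro k xs r l ys r'
      have h1 : ∑ i, ∑ j, r i * r' j * (G (xs i) (ys j) p).im =
          (∑ i, ∑ j, (r i : ℂ) * (r' j : ℂ) * G (xs i) (ys j) p).im := by
        rw [Complex.im_sum]; refine Finset.sum_congr rfl fun i _ => ?_
        rw [Complex.im_sum]; refine Finset.sum_congr rfl fun j _ => ?_
        simp [Complex.mul_im]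
      rw [h1, one_mul]
      exact (Complex.abs_im_le_norm _).trans (hcomb k xs r l ys r' p hp)
    obtain ⟨Tr, hTr, hTrn⟩ := exists_clm_of_real_bound δ hδ hreal (fun a b => (G a b p).re)
      zero_le_one hre
    obtain ⟨Ti, hTi, hTin⟩ := exists_clm_of_real_bound δ hδ hreal (fun a b => (G a b p).im)
      zero_le_one him
    refine ⟨Tr + Complex.I • Ti, fun a b => ?_, ?_⟩
    · rw [show (Tr + Complex.I • Ti) (δ b) = Tr (δ b) + Complex.I • Ti (δ b) from rfl, inner_add_right,
        inner_smul_right, hTr, hTi, mul_comm]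
      exact Complex.re_add_im _
    · calc ‖Tr + Complex.I • Ti‖ ≤ ‖Tr‖ + ‖Complex.I • Ti‖ := norm_add_le _ _
        _ = ‖Tr‖ + ‖Ti‖ := by rw [norm_smul, Complex.norm_I, one_mul]
        _ ≤ 4 * 1 + 4 * 1 := add_le_add hTrn hTin
        _ = 8 := by norm_num
  choose! N hN hNn using hT
  refine ⟨N, fun p hp => hNn p hp, fun a b => ?_, fun t y ht b => ?_, fun p hp a b => ?_⟩
  · exact (hGd a b).congr fun p hp => hN p hp a b
  · have hp : |((y : ℂ)).im| < ((t : ℂ)).re := by simpa using ht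
    refine ext_inner_gen δ hδ fun a => ?_
    have := hN ((t : ℂ), (y : ℂ)) hp a b
    rw [this, hGval' a b t y ht]
  · rw [hN _ (conj_mem_coneTube hp) a b, hN p hp a b]
    exact conj_apply_coneTube_of_real (hGd a b) (hGreal a b) p hp

omit [CompleteSpace H] in
/-- **Norm holomorphy along holomorphic curves into the tube.** If `N` is uniformly bounded on the
tube with holomorphic matrix elements on the kernel vectors, and `q : U → tube` is holomorphic on the
open `U ⊆ ℂ`, then `z ↦ N (q z)` is holomorphic in operator norm on `U` (weak holomorphy on the dense
span upgraded by Dunford's theorem). [cite: ReedSimonI1980, Thm. VI.4] -/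
theorem differentiableOn_coneFamily_comp [CompleteSpace H] (δ : X → H)
    (hδ : DenseRange (Finsupp.linearCombination ℂ δ)) {N : ℂ × ℂ → (H →L[ℂ] H)} {C : ℝ}
    (hNb : ∀ p : ℂ × ℂ, |p.2.im| < p.1.re → ‖N p‖ ≤ C)
    (hNd : ∀ a b, DifferentiableOn ℂ (fun p => ⟪δ a, N p (δ b)⟫_ℂ) {p : ℂ × ℂ | |p.2.im| < p.1.re})
    {U : Set ℂ} (hU : IsOpen U) {q : ℂ → ℂ × ℂ} (hq : DifferentiableOn ℂ q U)
    (hqU : ∀ z ∈ U, |(q z).2.im| < (q z).1.re) :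
    DifferentiableOn ℂ (fun z => N (q z)) U := by
  have hb : ∀ z ∈ U, ‖N (q z)‖ ≤ C := fun z hz => hNb _ (hqU z hz)
  refine differentiableOn_of_forall_differentiableOn_inner hU hb ?_
  refine differentiableOn_inner_of_dense (W := fun z => N (q z)) hU hb hδ hδ ?_
  rintro u ⟨c, rfl⟩ x ⟨c', rfl⟩
  have heq : (fun z => ⟪Finsupp.linearCombination ℂ δ c, N (q z) (Finsupp.linearCombination ℂ δ c')⟫_ℂ) =
      fun z => ∑ a ∈ c.support, ∑ b ∈ c'.support, conj (c a) * c' b * ⟪δ a, N (q z) (δ b)⟫_ℂ := by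
    funext z; exact inner_lc_clm_lc δ (N (q z)) c c'
  rw [heq]
  exact DifferentiableOn.fun_sum
    (A := fun a z => ∑ b ∈ c'.support, conj (c a) * c' b * ⟪δ a, N (q z) (δ b)⟫_ℂ)
    fun a _ => DifferentiableOn.fun_sum (A := fun b z => conj (c a) * c' b * ⟪δ a, N (q z) (δ b)⟫_ℂ)
      fun b _ => ((hNd a b).comp hq fun z hz => hqU z hz).const_mul (conj (c a) * c' b)

/-- **`J N(p) = N(p̄) J`** for the conjugation `J = conjOp δ`, from the reality relation of the
matrix elements. [folklore] -/
theorem conjOp_coneFamily_apply (δ : X → H) (hδ : DenseRange (Finsupp.linearCombination ℂ δ))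
    (hreal : ∀ x y, (⟪δ x, δ y⟫_ℂ).im = 0) {N : ℂ × ℂ → (H →L[ℂ] H)}
    (hNc : ∀ p : ℂ × ℂ, |p.2.im| < p.1.re → ∀ a b,
      ⟪δ a, N (conj p.1, conj p.2) (δ b)⟫_ℂ = conj ⟪δ a, N p (δ b)⟫_ℂ)
    {p : ℂ × ℂ} (hp : |p.2.im| < p.1.re) (φ : H) :
    conjOp δ (N p φ) = N (conj p.1, conj p.2) (conjOp δ φ) :=
  conjOp_clm_apply δ hδ hreal (hNc p hp) φ

end KernelVectors

end Literature.Analysis.OperatorTheory
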